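/-
Copyright (c) 2026 the pub-hodgecm-mathlib formalisation cell (harness21).  Prover seat hodgecm-mathlib-LH4-p14 (g3), req620 Track A «(D-RAM) FOUR-FRAME» squad
(unit U3_Laws, κ-STAGE B; brick «κ-BOX-SUM» (κ-B8 ∕ PART 2-κ) dealt by the dealer LH4-plan (g11) WORD #46 (1) ∕ #49 (1); κ owner LH4-p05 (g3); consumers: the (κ-B₀) payer of
F0P3a-p01 (g32) and this seat's (κS-B₀) assembler).  2026-09-04.
-/
import Summits.HodgeConjecture.HodgeConjecture.Theorems.F0P3cDyRamStableCountBoxReindex   -- ★ B10 PART 2 FILE 1 (LH4-p14 (g2)): the engine this brick mirrors (brings `Finset` algebra over `ℚ`, ★ B8)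
import Mathlib.Algebra.BigOperators.Intervals
import HarnessLib

/-!
# Crux `H413`, line LH4 «(D-RAM) FOUR-FRAME» road — unit U3_Laws (iii), κ-STAGE B, brick «κ-BOX-SUM» (κ-B8 ∕ PART 2-κ), FILE 1∕4 «BLOCKS»: the inner tube sum, the foot telescope, the glue-window re-index, the on-branch and tube rows

Cell `hodgecm-mathlib` (D-0151), FLOOR 0, crux item H413 = `stmt-HodgeConjecture-24833`, route of record `HCCMUnconditional`; squad F0∕P3c∕LH4 (req618∕req620); registered stubs served:
the κ-Stage-B children (κ-B₀) `F0P3cDyRamFourFrameU3.stub_U3_kappaCount_typeZero` and (κS-B₀) `…stub_U3_kappaSignCount_typeZero` of `Cruxes/H413/Lines/F0_P3c_DyRamFourFrame_U3_Laws.lean`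
ED. 10 (tree 4815bda2e7c89814), through the payers that feed THIS identity with the ★ κ-sockets.  THEOREMS ONLY (no `def`, no instance, no notation, no `sorry`, default heartbeats);
lane `--supports stmt-HodgeConjecture-24833` (count-neutral).  Precedent and engine: ★ B10 PART 2 «BOX RE-INDEX» `F0P3cDyRamStableCountBoxReindex{,Planes,Types}` (LH4-p14 (g2)) and
★ B8 `F0P3cDyRamStableCountSum` — the unsigned (MS) analogue `(q−1)·Σ = q^k − 1`.

THE MATHEMATICS (LH4-p05 (g3) PLAN-KMS v1 §4; per-stratum letters: ★ p856661 T-sockets (LH4-p04 (g2)), κG-C2 G-socket (LH4-p09 (g3)), κH-B2 H-socket (LH4-p06∕p08 (g3)); this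
seat's numerics `kappa_sum_tv0.v1` f242ecc3 ∕ `kappa_boxsum_leanshape.v1` 40f1a7eb, 1995∕1995 rows).  Fix a slot `i`.  The κ-weighted class count of the type-0 vertex lattices,
written stratum by stratum over the axis box, is a table with SIGN PARAMETERS: on-branch `T_p(s)`: `[i = p][2d ≤ s][2∣s][s ≤ n_p]·ω q^{s∕2}`; glued `G_p(ρ,s)`: TUBE
`[i = p]·ω q^{2ρ+s∕2−1}((q−1)[2d ≤ s] − [s+2 = 2d])` + GLUE SHELL at the apex foot (`n_legs = m < n_p = m+s`, `m < 2ρ ≤ 2m−d+1`) `ε·q^{2ρ+s∕2−c}`, `c = ⌈(2ρ−m)∕2⌉`, alive iff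
`2d ≤ s + 2c` (foot slot) resp. `d ≤ c` (cross slots); core-hanging `H(ρ)` (equilateral key only): `[d ≤ c]·εH·q^{2ρ−c}`; the core and the wild tubes' stable mass are DEAD.
THE IDENTITY: `(q − 1)·Σ_{box} = SIGN·(q^k − q^{k−B})`, `2k + d = Σn + 2`, `2B = n_i + 2(d%2) + 2 − 3d` (`B ≤ 0` ⇒ `0`), `SIGN = εH` (equilateral) ∕ the apex foot's glue entry at
slot `i`.  MECHANISM: in the slot's own (foot) plane the on-branch block `Σ_{d ≤ j ≤ ⌊n∕2⌋} q^j` is EXTENDED by the deep tubes and EATEN from below by the boundary tubes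
(`s + 2 = 2d`), telescoping to `ω·q^{[2⌊m∕2⌋+d, ⌊n∕2⌋+⌊m∕2⌋]}` when the apex excess is `≥ 2d` and to `0` otherwise; the alive glue cells are the consecutive powers above, up to
`q^{k−1}`; the two pieces tile `[k−B, k−1]` with ONE sign because «excess ≥ 2d ⇒ foot glue sign = ω» (the conductor side condition, a hypothesis here, discharged by the assemblers
with ★ `normSign_eq_one_of_fixed_of_v_sub_one_le`).  `2 ≤ d` is NEEDED (at `d = 1` the tame tube survives and the identity is false — 462 numeric counterexamples).

CONTENTS (FILE 1∕4 «BLOCKS»: the one-dimensional sums).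
* §Blocks `geom_Icc_mul` · `kappaTubeInner` (the inner tube sum of one foot ray, `d ≥ 2`) · `kappaFootTelescope` (on-branch block + tube rows telescope).
* §Reindex `sum_glueWindow_reindex` (the glue window `r = 2(⌊m∕2⌋ + c)`, `⌈(r−m)∕2⌉ = c`) · `sum_onBranch_kappa` (row `r = 0`) · `sum_tubeRow_kappa` (row `r = 2ρ`).
HONEST LABEL.  Count-neutral (`--supports stmt-HodgeConjecture-24833`); finite-sum bookkeeping over `ℚ`, nothing printed is asserted, no lattice enters; the κ-Stage-B children (κ-B₀)∕(κS-B₀) of U3 ED. 10 stay PROVER TARGETS until their payers land; `HC_CM` is proved only modulo the 7 printed citations (2 remaining named inputs: hLiu418 = `stmt-HodgeConjecture-24832`, h413 = `stmt-HodgeConjecture-24833`) until rung 0 closes.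

## References
* [Kottwitz1986BaseChangeUnits] R. E. Kottwitz, *Base change for unit elements of Hecke algebras*, Compositio Math. 60 (1986), §1 pp. 240–241 (κ-orbital integrals of units as signed lattice counts by position).
* [Rogawski1990] J. D. Rogawski, *Automorphic Representations of Unitary Groups in Three Variables*, Ann. of Math. Stud. 123 (1990), §4.9 Prop. 4.9.1 (a) p. 55, §4.10 p. 58 (the κ-signs on the classes inside a stable class).
-/

set_option autoImplicit false

namespace Summit.HodgeConjecture.HodgeConjecture.Cruxes.H413.F0P3cDyRamKappaCountBoxSumBlocks

open Finset

section Blocks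

variable {R : Type*} [CommRing R]

/-- Geometric block over a closed interval: `(x − 1)·Σ_{j ∈ [a, b]} x^j = x^{b+1} − x^a` for `a ≤ b + 1`. [folklore] -/
theorem geom_Icc_mul (x : R) {a b : ℕ} (hab : a ≤ b + 1) :
    (x - 1) * ∑ j ∈ Icc a b, x ^ j = x ^ (b + 1) - x ^ a := by
  induction b with
  | zero =>
    rcases Nat.eq_zero_or_pos a with rfl | ha
    · simp
    · have : a = 1 := by omega
      subst this
      simp
  | succ b ih =>
    rcases Nat.lt_or_ge (b + 1) a with hlt | hge
    · have : a = b + 2 := by omega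
      subst this
      simp
    · rw [Finset.sum_Icc_succ_top (by omega), mul_add, ih (by omega)]
      ring

/-- **THE INNER TUBE SUM of the κ-table** (type 0, one foot ray `r = 2ρ`): for `d ≥ 2`,
`Σ_{1 ≤ j ≤ U} x^{2ρ+j−1}·((x−1)[d ≤ j] − [j+1 = d]) = [d ≤ U](x^{2ρ+U} − x^{2ρ+d−1}) − [d ≤ U+1]·x^{2ρ+d−2}`. [folklore] -/
theorem kappaTubeInner (x : R) {d : ℕ} (hd : 2 ≤ d) (ρ U : ℕ) :
    ∑ j ∈ Icc 1 U, x ^ (2 * ρ + j - 1) * ((if d ≤ j then x - 1 else 0) - (if j + 1 = d then 1 else 0)) =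
      (if d ≤ U then x ^ (2 * ρ + U) - x ^ (2 * ρ + d - 1) else 0) - (if d ≤ U + 1 then x ^ (2 * ρ + d - 2) else 0) := by
  induction U with
  | zero =>
    have hA : ¬ d ≤ 0 := by omega
    have hB : ¬ d ≤ 0 + 1 := by omega
    rw [Finset.Icc_eq_empty_of_lt (by omega), Finset.sum_empty, if_neg hA, if_neg hB, sub_zero]
  | succ U ih =>
    rw [Finset.sum_Icc_succ_top (by omega), ih]
    have e : 2 * ρ + (U + 1) - 1 = 2 * ρ + U := by omega
    rw [e]
    by_cases hA : d ≤ U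
    · have hB : d ≤ U + 1 := by omega
      have hC : ¬ (U + 1 + 1 = d) := by omega
      have hD : d ≤ U + 1 + 1 := by omega
      simp only [if_pos hA, if_pos hB, if_neg hC, if_pos hD]
      rw [show x ^ (2 * ρ + (U + 1)) = x ^ (2 * ρ + U) * x by rw [← pow_succ]; rfl]
      ring
    · by_cases hB : d ≤ U + 1
      · have hdU : d = U + 1 := by omega
        have hC : ¬ (U + 1 + 1 = d) := by omega
        have hD : d ≤ U + 1 + 1 := by omega
        simp only [if_neg hA, if_pos hB, if_neg hC, if_pos hD]
        have e1 : x ^ (2 * ρ + (U + 1)) = x ^ (2 * ρ + U) * x := by rw [← pow_succ]; rfl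
        have e2 : x ^ (2 * ρ + d - 1) = x ^ (2 * ρ + U) := by rw [hdU]; congr 1
        have e3 : x ^ (2 * ρ + U) = x ^ (2 * ρ + d - 2) * x := by rw [← pow_succ]; congr 1; omega
        rw [e1, e2, e3]; ring
      · by_cases hD : d ≤ U + 1 + 1
        · have hC : U + 1 + 1 = d := by omega
          simp only [if_neg hA, if_neg hB, if_pos hC, if_pos hD]
          have e3 : x ^ (2 * ρ + U) = x ^ (2 * ρ + d - 2) := by congr 1; omega
          rw [e3]; ring
        · have hC : ¬ (U + 1 + 1 = d) := by omega
          simp only [if_neg hA, if_neg hB, if_neg hC, if_neg hD]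
          ring

/-- **THE FOOT TELESCOPE** (T-strata + tubes of one foot plane): with `inner ρ := [ρ+d ≤ N](x^{N+ρ} − x^{2ρ+d−1}) − [ρ+d ≤ N+1] x^{2ρ+d−2}`,
`Σ_{d ≤ j ≤ N} x^j + Σ_{1 ≤ ρ ≤ Rr} inner ρ = [Rr + d ≤ N]·Σ_{2Rr+d ≤ j ≤ N+Rr} x^j` — the deep tubes extend the on-branch block and the boundary tubes eat it from below. [folklore] -/
theorem kappaFootTelescope (x : R) {d : ℕ} (hd : 1 ≤ d) (N Rr : ℕ) :
    ∑ j ∈ Icc d N, x ^ j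
      + ∑ ρ ∈ Icc 1 Rr, ((if ρ + d ≤ N then x ^ (N + ρ) - x ^ (2 * ρ + d - 1) else 0) - (if ρ + d ≤ N + 1 then x ^ (2 * ρ + d - 2) else 0)) =
      if Rr + d ≤ N then ∑ j ∈ Icc (2 * Rr + d) (N + Rr), x ^ j else 0 := by
  induction Rr with
  | zero =>
    rw [Finset.Icc_eq_empty_of_lt (by omega : (0 : ℕ) < 1), Finset.sum_empty, add_zero]
    by_cases h : 0 + d ≤ N
    · rw [if_pos h]; simp
    · rw [if_neg h, Finset.Icc_eq_empty_of_lt (by omega), Finset.sum_empty]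
  | succ Rr ih =>
    rw [Finset.sum_Icc_succ_top (by omega), ← add_assoc, ih]
    by_cases h1 : Rr + 1 + d ≤ N
    · have hA : Rr + d ≤ N := by omega
      have hB : Rr + 1 + d ≤ N + 1 := by omega
      rw [if_pos hA, if_pos h1, if_pos h1, if_pos hB]
      -- Σ_{[2Rr+d, N+Rr]} + x^{N+Rr+1} - x^{2Rr+d+1} - x^{2Rr+d} = Σ_{[2Rr+d+2, N+Rr+1]}
      have hsplit : ∑ j ∈ Icc (2 * Rr + d) (N + Rr), x ^ j = x ^ (2 * Rr + d) + x ^ (2 * Rr + d + 1) + ∑ j ∈ Icc (2 * Rr + d + 2) (N + Rr), x ^ j := by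
        have e1 : Icc (2 * Rr + d) (N + Rr) = insert (2 * Rr + d) (Icc (2 * Rr + d + 1) (N + Rr)) := by
          ext j; simp only [Finset.mem_Icc, Finset.mem_insert]; omega
        have e2 : Icc (2 * Rr + d + 1) (N + Rr) = insert (2 * Rr + d + 1) (Icc (2 * Rr + d + 2) (N + Rr)) := by
          ext j; simp only [Finset.mem_Icc, Finset.mem_insert]; omega
        rw [e1, Finset.sum_insert (by simp), e2, Finset.sum_insert (by simp)]
        ring
      have htop : ∑ j ∈ Icc (2 * (Rr + 1) + d) (N + (Rr + 1)), x ^ j = (∑ j ∈ Icc (2 * Rr + d + 2) (N + Rr), x ^ j) + x ^ (N + Rr + 1) := by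
        have e : 2 * (Rr + 1) + d = 2 * Rr + d + 2 := by ring
        have e' : N + (Rr + 1) = N + Rr + 1 := by ring
        rw [e, e', Finset.sum_Icc_succ_top (by omega)]
      rw [hsplit, htop]
      have e3 : 2 * (Rr + 1) + d - 1 = 2 * Rr + d + 1 := by omega
      have e4 : 2 * (Rr + 1) + d - 2 = 2 * Rr + d := by omega
      have e5 : N + (Rr + 1) = N + Rr + 1 := by ring
      rw [e3, e4, e5]; ring
    · rw [if_neg h1]
      by_cases h2 : Rr + d ≤ N
      · -- the last live foot cell: Rr + d = N
        have hRN : Rr + d = N := by omega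
        have hB : Rr + 1 + d ≤ N + 1 := by omega
        rw [if_pos h2, if_neg h1, if_pos hB]
        have e : Icc (2 * Rr + d) (N + Rr) = {2 * Rr + d} := by
          rw [← hRN]; ext j; simp only [Finset.mem_Icc, Finset.mem_singleton]; omega
        have e4 : 2 * (Rr + 1) + d - 2 = 2 * Rr + d := by omega
        rw [e, Finset.sum_singleton, e4]; ring
      · have hB : ¬ Rr + 1 + d ≤ N + 1 := by omega
        rw [if_neg h2, if_neg h1, if_neg hB]; ring

end Blocks

section Reindex

variable {R : Type*} [CommRing R]

/-- **THE GLUE WINDOW RE-INDEXED**: the even `r` with `m < r`, `r − m ≤ m − d + 1` (`m ≡ d (mod 2)`, `d ≤ m`, `2m ≤ B`) are `r = 2(⌊m/2⌋ + c)`, `1 ≤ c ≤ (m−d)/2 + d%2`,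
with `⌈(r−m)/2⌉ = (r − m + 1)/2 = c` and `r − c = 2⌊m/2⌋ + c`. [folklore] -/
theorem sum_glueWindow_reindex (F : ℕ → ℕ → R) {m d B : ℕ} (hpar : m % 2 = d % 2) (hdm : d ≤ m) (hB : 2 * m ≤ B) :
    ∑ r ∈ range (B + 1), (if 2 ∣ r ∧ m < r ∧ r - m ≤ m - d + 1 then F ((r - m + 1) / 2) (r - (r - m + 1) / 2) else 0)
      = ∑ c ∈ Icc 1 ((m - d) / 2 + d % 2), F c (2 * (m / 2) + c) := by
  rw [← Finset.sum_filter]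
  have hinj : Set.InjOn (fun c : ℕ => 2 * (m / 2) + 2 * c) ↑(Icc 1 ((m - d) / 2 + d % 2)) := by
    intro u _ v _ huv
    have : 2 * (m / 2) + 2 * u = 2 * (m / 2) + 2 * v := huv
    omega
  have hset : (range (B + 1)).filter (fun r => 2 ∣ r ∧ m < r ∧ r - m ≤ m - d + 1) = (Icc 1 ((m - d) / 2 + d % 2)).image (fun c => 2 * (m / 2) + 2 * c) := by
    ext r
    simp only [Finset.mem_filter, Finset.mem_range, Finset.mem_image, Finset.mem_Icc, Nat.dvd_iff_mod_eq_zero]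
    constructor
    · rintro ⟨hrB, hr2, hmr, hrm⟩
      refine ⟨r / 2 - m / 2, ⟨by omega, by omega⟩, by omega⟩
    · rintro ⟨c, ⟨hc1, hc2⟩, rfl⟩
      refine ⟨by omega, by omega, by omega, by omega⟩
  rw [hset, Finset.sum_image hinj]
  refine Finset.sum_congr rfl fun c hc => ?_
  simp only [Finset.mem_Icc] at hc
  have e1 : (2 * (m / 2) + 2 * c - m + 1) / 2 = c := by omega
  have e2 : 2 * (m / 2) + 2 * c - c = 2 * (m / 2) + c := by omega
  rw [e1, e2]

/-- **THE ON-BRANCH κ-BLOCK** (row `r = 0` of a foot plane): `Σ_{t ≤ B} [2d ≤ t, t even, t ≤ n]·ω x^{t/2} = ω·Σ_{d ≤ j ≤ ⌊n/2⌋} x^j`. [folklore] -/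
theorem sum_onBranch_kappa (x ω : R) {d n B : ℕ} (hnB : n ≤ B) :
    ∑ t ∈ range (B + 1), (if 2 * d ≤ t ∧ 2 ∣ t ∧ t ≤ n then ω * x ^ (t / 2) else 0) = ω * ∑ j ∈ Icc d (n / 2), x ^ j := by
  rw [← Finset.sum_filter, Finset.mul_sum]
  have hinj : Set.InjOn (fun j : ℕ => 2 * j) ↑(Icc d (n / 2)) := by
    intro u _ v _ huv
    have : 2 * u = 2 * v := huv
    omega
  have hset : (range (B + 1)).filter (fun t => 2 * d ≤ t ∧ 2 ∣ t ∧ t ≤ n) = (Icc d (n / 2)).image (fun j => 2 * j) := by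
    ext t
    simp only [Finset.mem_filter, Finset.mem_range, Finset.mem_image, Finset.mem_Icc, Nat.dvd_iff_mod_eq_zero]
    constructor
    · rintro ⟨htB, hdt, ht2, htn⟩
      exact ⟨t / 2, ⟨by omega, by omega⟩, by omega⟩
    · rintro ⟨j, ⟨hj1, hj2⟩, rfl⟩
      exact ⟨by omega, by omega, by omega, by omega⟩
  rw [hset, Finset.sum_image hinj]
  refine Finset.sum_congr rfl fun j _ => ?_
  rw [Nat.mul_div_cancel_left j (by norm_num : 0 < 2)]

/-- **THE TUBE ROW of a foot plane at `r = 2ρ`** (`ρ ≥ 1`): `Σ_{t ≤ B} [2ρ < t, t − 2ρ even, t ≤ n]·ω x^{2ρ+(t−2ρ)/2−1}((x−1)[2d ≤ t−2ρ] − [t−2ρ+2 = 2d])`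
`= ω·([ρ + d ≤ N](x^{N+ρ} − x^{2ρ+d−1}) − [ρ + d ≤ N+1]·x^{2ρ+d−2})`, `N = ⌊n/2⌋` (`d ≥ 2`). [folklore] -/
theorem sum_tubeRow_kappa (x ω : R) {d n B : ℕ} (hd : 2 ≤ d) (hnB : n ≤ B) (ρ : ℕ) (hρ : 1 ≤ ρ) :
    ∑ t ∈ range (B + 1), (if 2 * ρ < t ∧ 2 ∣ (t - 2 * ρ) ∧ t ≤ n then
        ω * x ^ (2 * ρ + (t - 2 * ρ) / 2 - 1) * ((if 2 * d ≤ t - 2 * ρ then x - 1 else 0) - (if t - 2 * ρ + 2 = 2 * d then 1 else 0)) else 0)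
      = ω * ((if ρ + d ≤ n / 2 then x ^ (n / 2 + ρ) - x ^ (2 * ρ + d - 1) else 0) - (if ρ + d ≤ n / 2 + 1 then x ^ (2 * ρ + d - 2) else 0)) := by
  rw [← Finset.sum_filter]
  have hinj : Set.InjOn (fun j : ℕ => 2 * ρ + 2 * j) ↑(Icc 1 (n / 2 - ρ)) := by
    intro u _ v _ huv
    have : 2 * ρ + 2 * u = 2 * ρ + 2 * v := huv
    omega
  have hset : (range (B + 1)).filter (fun t => 2 * ρ < t ∧ 2 ∣ (t - 2 * ρ) ∧ t ≤ n) = (Icc 1 (n / 2 - ρ)).image (fun j => 2 * ρ + 2 * j) := by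
    ext t
    simp only [Finset.mem_filter, Finset.mem_range, Finset.mem_image, Finset.mem_Icc, Nat.dvd_iff_mod_eq_zero]
    constructor
    · rintro ⟨htB, hρt, ht2, htn⟩
      exact ⟨(t - 2 * ρ) / 2, ⟨by omega, by omega⟩, by omega⟩
    · rintro ⟨j, ⟨hj1, hj2⟩, rfl⟩
      exact ⟨by omega, by omega, by omega, by omega⟩
  rw [hset, Finset.sum_image hinj]
  have hsummand : ∀ j ∈ Icc 1 (n / 2 - ρ),
      ω * x ^ (2 * ρ + (2 * ρ + 2 * j - 2 * ρ) / 2 - 1) * ((if 2 * d ≤ 2 * ρ + 2 * j - 2 * ρ then x - 1 else 0) - (if 2 * ρ + 2 * j - 2 * ρ + 2 = 2 * d then 1 else 0))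
        = ω * (x ^ (2 * ρ + j - 1) * ((if d ≤ j then x - 1 else 0) - (if j + 1 = d then 1 else 0))) := by
    intro j _
    have e1 : 2 * ρ + (2 * ρ + 2 * j - 2 * ρ) / 2 - 1 = 2 * ρ + j - 1 := by omega
    have e2 : (2 * d ≤ 2 * ρ + 2 * j - 2 * ρ) = (d ≤ j) := propext ⟨fun h => by omega, fun h => by omega⟩
    have e3 : (2 * ρ + 2 * j - 2 * ρ + 2 = 2 * d) = (j + 1 = d) := propext ⟨fun h => by omega, fun h => by omega⟩
    rw [e1, mul_assoc]
    simp only [e2, e3]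
  rw [Finset.sum_congr rfl hsummand, ← Finset.mul_sum, kappaTubeInner x hd ρ (n / 2 - ρ)]
  congr 1
  by_cases h1 : ρ + d ≤ n / 2
  · have hA : d ≤ n / 2 - ρ := by omega
    have hB : d ≤ n / 2 - ρ + 1 := by omega
    have hC : ρ + d ≤ n / 2 + 1 := by omega
    have e : 2 * ρ + (n / 2 - ρ) = n / 2 + ρ := by omega
    rw [if_pos hA, if_pos h1, if_pos hB, if_pos hC, e]
  · have hA : ¬ d ≤ n / 2 - ρ := by omega
    rw [if_neg hA, if_neg h1]
    by_cases h2 : ρ + d ≤ n / 2 + 1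
    · have hB : d ≤ n / 2 - ρ + 1 := by omega
      rw [if_pos hB, if_pos h2]
    · have hB : ¬ d ≤ n / 2 - ρ + 1 := by omega
      rw [if_neg hB, if_neg h2]

end Reindex

end Summit.HodgeConjecture.HodgeConjecture.Cruxes.H413.F0P3cDyRamKappaCountBoxSumBlocks
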